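import Literature.Analysis.FluidPDE.TorusNSStrainProjectionCriterion
import Literature.Analysis.FunctionSpaces.TorusSpaceTimeTaylor
import HarnessLib

/-!
# The Navier–Stokes strain equation on `T³` in Miller's projected form:
# `∂ₜS − νΔS + P_{st}((u·∇)S + S² + ¼ω⊗ω) = 0` (ARMA 235 (2020) Prop 2.1 + Prop 2.4; Anal. PDE 16 (2023) (1.9))

Analysis/FluidPDE proof file (theorems only, no definitions, no named facts).
Search for candidate a priori estimates; no regularity claim.

E. Miller, *A regularity criterion for the Navier–Stokes equation involving only the middle eigenvalue
of the strain tensor*, Arch. Ration. Mech. Anal. 235 (2020) 99–139 (= arXiv:1710.05569), proves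

* **Prop 2.1 (Strain reformulation of the dynamics).** "Suppose `u` is a classical solution to the
  Navier–Stokes equation. Then `S = ∇_{sym}(u)` is a classical solution to the Navier–Stokes strain
  equation `∂ₜS + (u·∇)S − ΔS + S² + ¼ω⊗ω − ¼|ω|²I₃ + Hess(p) = 0`." (proof: apply `∇_{sym}` to the
  equation, `∇_{sym}((u·∇)u) = (u·∇)S + S² + A²`, `A² = ¼ω⊗ω − ¼|ω|²I₃`);
* **Prop 2.4 (Orthogonal subspaces).** `⟨S, gI₃⟩ = 0`, `⟨S, Hess(f)⟩ = 0` for all `S ∈ L²_{st}`;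

and E. Miller, Anal. PDE 16 (2023) 997–1032 (= arXiv:1910.05415), (1.9), records the consequence "the
Navier–Stokes strain equation can be expressed in terms of the projection onto `L²_{st}` as
`∂ₜS − ΔS + P_{st}((u·∇)S + S² + ¼ω⊗ω) = 0`" — the form in which the strain equation enters the
perturbative criteria of Pure Appl. Anal. 8 (2026) (tree `TorusNSStrainProjectionCriterion`) and the
perturbative blow-up condition Anal. PDE 16 (2023) Thm 6.1 (= PAA 8 (2026) Thm 1.10, not typed).

Here, on the unit torus `T^d` (any `d` for the `W`-forms; `card d = 3` through a frame `e : d ≃ Fin 3`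
for the `ω`-forms, `ωₐ = W_{e⁻¹(e a+1), e⁻¹(e a+2)}`), for smooth fields and for CLASSICAL solutions of
the unforced system (`Torus.IsClassicalNSSolutionOn (Icc a b) ν 0 u p`, viscosity `ν` explicit, time
derivatives one-sided within `[a, b]`), with `P_{st} = Torus.strainProjection` the explicit operator of
`TorusStrainProjection`, we prove:

* **linearity of `P_{st}`** (it is an orthogonal projection, ARMA Def 2.2): `Torus.strainProjection_add`,
  `Torus.strainProjection_const_mul`, `Torus.strainProjection_sub` (smooth matrix fields);
* `StrainEquationProjected.vorticity_mul_vorticity_eq`: **`ωₐω_b = (W²)ₐ_b + δₐ_b|ω|²`** entrywise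
  (Majda–Bertozzi (1.21); the tree had the quadratic-form version);
* **`Torus.strainProjection_symGradConvect_vorticityTensor_eq`** (every `d`) and
  **`Torus.strainProjection_symGradConvect_vorticity_eq`** (`T³`): for smooth divergence-free `u` and
  smooth `p` with `div((u·∇)u + ∇p) = 0`,
  `P_{st}((u·∇)S + S² + ¼W²) = P_{st}((u·∇)S + S² + ¼ω⊗ω) = ∇_{sym}((u·∇)u + ∇p)` — Prop 2.1's algebra,
  Prop 2.4 (`P_{st}Hess(p) = 0`, `P_{st}(|ω|²I) = 0`, tree `Torus.strainProjection_hessian/_diagonal`)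
  and `P_{st}∇_{sym}w = ∇_{sym}w` for divergence-free `w` (tree `Torus.strainProjection_symGrad`);
* **`Torus.IsClassicalNSSolutionOn.isDivFree_convect_add_gradient`**: `div((u·∇)u + ∇p) = 0` along
  classical solutions (`= div(νΔu − ∂ₜu)`; RRS (5.3));
* **`Torus.IsClassicalNSSolutionOn.timeDerivWithin_strain_eq`** — the projected strain equation along
  classical solutions on `T³`: `∂ₜS_{ij} = ν(ΔS)_{ij} − (P_{st}((u·∇)S + S² + ¼ω⊗ω))_{ij}`;
* **`Torus.IsClassicalNSSolutionOn.timeDerivWithin_strain_eq_vorticityTensor`** (every `d`, `W`-form) and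
  **`….timeDerivWithin_strain_eq_vorticity`** (`T³`, as printed): Prop 2.1 itself,
  `∂ₜS_{ij} = ν(ΔS)_{ij} − ((u·∇)S)_{ij} − (S²)_{ij} − ¼ωᵢωⱼ + ¼|ω|²δ_{ij} − ∂ᵢ∂ⱼp`.

Scope (faithfulness): Miller states Prop 2.1 on `ℝ³` with `ν = 1` for classical solutions; the
computation is pointwise algebra plus `∂ₜ∂ᵢ = ∂ᵢ∂ₜ`, identical on `T³`; `ν` is carried explicitly.
The matrix fields are written out entrywise (`S_{ab} = ½((∂_b u)_a + (∂_a u)_b)`,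
`((u·∇)S)_{ab} = ∑_c u_c ∂_c S_{ab}`, `(S²)_{ab} = ∑_c S_{ac}S_{cb}`), in the shapes of
`StrainProjectionCriterion.symGrad_convect_apply` and `Torus.strainPerturbation`. Nothing about regularity
of Navier–Stokes follows; these are exact identities. They serve the functional-mining cell (pub-nsfunc):
the dictionary's strain family can now differentiate strain functionals along classical solutions with
the projected nonlinearity in closed form (CRITERIA row A25; the prerequisite of PAA 2026 Thm 1.10).

## Mathlib / tree search

Tree (used): `Torus.strainProjection` API (`TorusStrainProjection`: `strainProjection_symGrad`,
`strainProjection_hessian`, `strainProjection_diagonal`, `strainPotential_apply`, `isSmooth_strainDiv`,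
`isSmooth_strainDivDiv`, `isSmooth_strainPotential`); `StrainProjectionCriterion.symGrad_convect_apply`
(`TorusNSStrainProjectionCriterion`); `StrainVorticityOrthogonality.sum_vorticity_mul_mul_vorticity_eq`
(`TorusStrainVorticityOrthogonality`); `Torus.invLaplacian_add`, `invLaplacian_const_smul`,
`partialDeriv_add/_sub/_const_smul`, `partialDeriv_apply_coord`, `partialDeriv_comm`, `gradient_apply`,
`divergence_eq_sum_partialDeriv_apply`, `IsDivFree.laplacian_of_isSmooth` (`TorusClassicalH1Balance`),
`IsSmoothSpaceTimeOn.isDivFree_timeDerivWithin` (`TorusSpaceTimeTaylor`), `timeDerivWithin_partialDeriv_comm`,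
`timeDerivWithin_clm_comp/_add/_const_smul` (`TorusInverseLaplacianCalculus`). Searched (`lean search`):
`strainProjection_add|strain equation|timeDerivWithin_strain` — nothing before this file.

## References

* [Miller2019] E. Miller, Arch. Ration. Mech. Anal. 235 (2020) 99–139 = arXiv:1710.05569: Prop 2.1
  with proof, Def 2.2, Prop 2.4 (held text paper:arxiv-1710.05569, pp. 8–9).
* [Miller2023StrainModel] E. Miller, Anal. PDE 16 (2023) 997–1032 = arXiv:1910.05415: eq. (1.9)
  (projected strain equation), §6 Thm 6.1 (context; held text pp. 4, 20).
* [Miller2026StrainVorticity] E. Miller, Pure Appl. Anal. 8 (2026) 247–270: (1.4)–(1.6), (5.9).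
* [MajdaBertozziCUP2002] A. Majda, A. Bertozzi, Vorticity and Incompressible Flow, §1.4 eq. (1.21).
* [RobinsonRodrigoSadowskiCUP2016] Ch. 5 eq. (5.3) (pressure Poisson equation).
-/

noncomputable section

open MeasureTheory Set Function Finset

namespace Literature.Analysis.FluidPDE

open Literature.Analysis.FunctionSpaces Literature.Analysis.FunctionSpaces.Torus
  StrainProjectionCriterion StrainVorticityOrthogonality

variable {d : Type*} [Fintype d] [DecidableEq d]

namespace StrainEquationProjected

omit [DecidableEq d] in
/-- Finite sums of smooth scalar functions are smooth. [folklore] -/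
private theorem isSmooth_sum' {ι : Type*} (s : Finset ι) {g : ι → UnitAddTorus d → ℝ}
    (hg : ∀ i ∈ s, Torus.IsSmooth (g i)) : Torus.IsSmooth (fun x => ∑ i ∈ s, g i x) := by
  have hl : Torus.lift (fun x => ∑ i ∈ s, g i x) = fun z => ∑ i ∈ s, Torus.lift (g i) z := rfl
  unfold Torus.IsSmooth
  rw [hl]
  exact ContDiff.sum fun i hi => hg i hi

omit [DecidableEq d] in
/-- Products of smooth scalar functions are smooth (pointwise form). [folklore] -/
private theorem smooth_mul' {a b : UnitAddTorus d → ℝ} (ha : Torus.IsSmooth a) (hb : Torus.IsSmooth b) :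
    Torus.IsSmooth (fun y => a y * b y) := ha.mul hb

omit [DecidableEq d] in
/-- Squares of smooth scalar functions are smooth (pointwise form). [folklore] -/
private theorem smooth_sq' {a : UnitAddTorus d → ℝ} (ha : Torus.IsSmooth a) :
    Torus.IsSmooth (fun y => a y ^ 2) := ha.pow 2

/-! ### Linearity of `P_{st}` -/

variable {M N : d → d → UnitAddTorus d → ℝ}

omit [DecidableEq d] in
/-- Symmetrised entries are smooth. [folklore] -/
private theorem isSmooth_symm (hM : ∀ a b, Torus.IsSmooth (M a b)) (c b : d) :
    Torus.IsSmooth (fun z => (M c b z + M b c z) / 2) :=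
  ((hM c b).add (hM b c)).div_const 2

/-- `div_{sym}` is additive. [folklore] -/
private theorem strainDiv_add (hM : ∀ a b, Torus.IsSmooth (M a b)) (hN : ∀ a b, Torus.IsSmooth (N a b))
    (b : d) : Torus.strainDiv (fun a c x => M a c x + N a c x) b =
      fun y => Torus.strainDiv M b y + Torus.strainDiv N b y := by
  funext y
  simp only [Torus.strainDiv, ← Finset.sum_add_distrib]
  refine Finset.sum_congr rfl fun c _ => ?_
  have hfun : (fun z => (M c b z + N c b z + (M b c z + N b c z)) / 2) =
      (fun z => (M c b z + M b c z) / 2) + fun z => (N c b z + N b c z) / 2 := by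
    funext z; simp only [Pi.add_apply]; ring
  rw [hfun, Torus.partialDeriv_add ((isSmooth_symm hM c b).isContDiff (by simp))
    ((isSmooth_symm hN c b).isContDiff (by simp)), Pi.add_apply]

/-- `div_{sym}` is homogeneous. [folklore] -/
private theorem strainDiv_const_mul (hM : ∀ a b, Torus.IsSmooth (M a b)) (r : ℝ) (b : d) :
    Torus.strainDiv (fun a c x => r * M a c x) b = fun y => r * Torus.strainDiv M b y := by
  funext y
  simp only [Torus.strainDiv, Finset.mul_sum]
  refine Finset.sum_congr rfl fun c _ => ?_
  have hfun : (fun z => (r * M c b z + r * M b c z) / 2) = r • fun z => (M c b z + M b c z) / 2 := by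
    funext z; simp only [Pi.smul_apply, smul_eq_mul]; ring
  rw [hfun, Torus.partialDeriv_const_smul ((isSmooth_symm hM c b).isContDiff (by simp)), Pi.smul_apply,
    smul_eq_mul]

/-- `div div sym` is additive. [folklore] -/
private theorem strainDivDiv_add (hM : ∀ a b, Torus.IsSmooth (M a b)) (hN : ∀ a b, Torus.IsSmooth (N a b)) :
    Torus.strainDivDiv (fun a c x => M a c x + N a c x) =
      fun y => Torus.strainDivDiv M y + Torus.strainDivDiv N y := by
  funext y
  simp only [Torus.strainDivDiv, ← Finset.sum_add_distrib]
  refine Finset.sum_congr rfl fun b _ => ?_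
  rw [strainDiv_add hM hN b]
  have hfun : (fun y => Torus.strainDiv M b y + Torus.strainDiv N b y) =
      Torus.strainDiv M b + Torus.strainDiv N b := rfl
  rw [hfun, Torus.partialDeriv_add ((Torus.isSmooth_strainDiv hM b).isContDiff (by simp))
    ((Torus.isSmooth_strainDiv hN b).isContDiff (by simp)), Pi.add_apply]

/-- `div div sym` is homogeneous. [folklore] -/
private theorem strainDivDiv_const_mul (hM : ∀ a b, Torus.IsSmooth (M a b)) (r : ℝ) :
    Torus.strainDivDiv (fun a c x => r * M a c x) = fun y => r * Torus.strainDivDiv M y := by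
  funext y
  simp only [Torus.strainDivDiv, Finset.mul_sum]
  refine Finset.sum_congr rfl fun b _ => ?_
  rw [strainDiv_const_mul hM r b]
  have hfun : (fun y => r * Torus.strainDiv M b y) = r • Torus.strainDiv M b := rfl
  rw [hfun, Torus.partialDeriv_const_smul ((Torus.isSmooth_strainDiv hM b).isContDiff (by simp)),
    Pi.smul_apply, smul_eq_mul]

/-- The potential `z_M` is additive in `M`. [folklore] -/
private theorem strainPotential_add [Nonempty d] (hM : ∀ a b, Torus.IsSmooth (M a b))
    (hN : ∀ a b, Torus.IsSmooth (N a b)) :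
    Torus.strainPotential (fun a c x => M a c x + N a c x) =
      Torus.strainPotential M + Torus.strainPotential N := by
  funext y
  ext b
  rw [Pi.add_apply, PiLp.add_apply, Torus.strainPotential_apply, Torus.strainPotential_apply,
    Torus.strainPotential_apply, strainDiv_add hM hN, strainDivDiv_add hM hN]
  have h1 : (fun y => Torus.strainDiv M b y + Torus.strainDiv N b y) =
      Torus.strainDiv M b + Torus.strainDiv N b := rfl
  have h2 : (fun y => Torus.strainDivDiv M y + Torus.strainDivDiv N y) =
      Torus.strainDivDiv M + Torus.strainDivDiv N := rfl
  have hDM := Torus.isSmooth_strainDiv hM b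
  have hDN := Torus.isSmooth_strainDiv hN b
  have hDDM := Torus.isSmooth_strainDivDiv hM
  have hDDN := Torus.isSmooth_strainDivDiv hN
  rw [h1, h2, Torus.invLaplacian_add hDM hDN, Torus.invLaplacian_add hDDM hDDN,
    Torus.invLaplacian_add (Torus.isSmooth_invLaplacian hDDM) (Torus.isSmooth_invLaplacian hDDN),
    Torus.partialDeriv_add ((Torus.isSmooth_invLaplacian (Torus.isSmooth_invLaplacian hDDM)).isContDiff (by simp))
      ((Torus.isSmooth_invLaplacian (Torus.isSmooth_invLaplacian hDDN)).isContDiff (by simp))]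
  simp only [Pi.add_apply]
  ring

/-- The potential `z_M` is homogeneous in `M`. [folklore] -/
private theorem strainPotential_const_mul [Nonempty d] (hM : ∀ a b, Torus.IsSmooth (M a b)) (r : ℝ) :
    Torus.strainPotential (fun a c x => r * M a c x) = r • Torus.strainPotential M := by
  funext y
  ext b
  rw [Pi.smul_apply, PiLp.smul_apply, Torus.strainPotential_apply, Torus.strainPotential_apply,
    strainDiv_const_mul hM r, strainDivDiv_const_mul hM r]
  have h1 : (fun y => r * Torus.strainDiv M b y) = r • Torus.strainDiv M b := rfl
  have h2 : (fun y => r * Torus.strainDivDiv M y) = r • Torus.strainDivDiv M := rfl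
  have hDM := Torus.isSmooth_strainDiv hM b
  have hDDM := Torus.isSmooth_strainDivDiv hM
  rw [h1, h2, Torus.invLaplacian_const_smul r _ hDM, Torus.invLaplacian_const_smul r _ hDDM,
    Torus.invLaplacian_const_smul r _ (Torus.isSmooth_invLaplacian hDDM),
    Torus.partialDeriv_const_smul
      ((Torus.isSmooth_invLaplacian (Torus.isSmooth_invLaplacian hDDM)).isContDiff (by simp))]
  simp only [Pi.smul_apply, smul_eq_mul]
  ring

/-- **`P_{st}` is additive**: `P_{st}(M + N) = P_{st}M + P_{st}N` for smooth matrix fields (it is a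
linear operator — the orthogonal projection onto `L²_{st}`, Miller, ARMA 235 (2020), Def 2.2).
[cite: Miller2019, Def 2.2] -/
theorem _root_.Literature.Analysis.FluidPDE.Torus.strainProjection_add [Nonempty d]
    (hM : ∀ a b, Torus.IsSmooth (M a b)) (hN : ∀ a b, Torus.IsSmooth (N a b)) (a b : d) (x : UnitAddTorus d) :
    Torus.strainProjection (fun a c y => M a c y + N a c y) a b x =
      Torus.strainProjection M a b x + Torus.strainProjection N a b x := by
  simp only [Torus.strainProjection]
  rw [strainPotential_add hM hN,
    Torus.partialDeriv_add ((Torus.isSmooth_strainPotential hM).isContDiff (by simp))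
      ((Torus.isSmooth_strainPotential hN).isContDiff (by simp)),
    Torus.partialDeriv_add ((Torus.isSmooth_strainPotential hM).isContDiff (by simp))
      ((Torus.isSmooth_strainPotential hN).isContDiff (by simp))]
  simp only [Pi.add_apply, PiLp.add_apply]
  ring

/-- **`P_{st}` is homogeneous**: `P_{st}(rM) = r P_{st}M`. [cite: Miller2019, Def 2.2] -/
theorem _root_.Literature.Analysis.FluidPDE.Torus.strainProjection_const_mul [Nonempty d]
    (hM : ∀ a b, Torus.IsSmooth (M a b)) (r : ℝ) (a b : d) (x : UnitAddTorus d) :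
    Torus.strainProjection (fun a c y => r * M a c y) a b x = r * Torus.strainProjection M a b x := by
  simp only [Torus.strainProjection]
  rw [strainPotential_const_mul hM r,
    Torus.partialDeriv_const_smul ((Torus.isSmooth_strainPotential hM).isContDiff (by simp)),
    Torus.partialDeriv_const_smul ((Torus.isSmooth_strainPotential hM).isContDiff (by simp))]
  simp only [Pi.smul_apply, PiLp.smul_apply, smul_eq_mul]
  ring

/-- **`P_{st}` respects differences**: `P_{st}(M − N) = P_{st}M − P_{st}N`. [cite: Miller2019, Def 2.2] -/
theorem _root_.Literature.Analysis.FluidPDE.Torus.strainProjection_sub [Nonempty d]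
    (hM : ∀ a b, Torus.IsSmooth (M a b)) (hN : ∀ a b, Torus.IsSmooth (N a b)) (a b : d) (x : UnitAddTorus d) :
    Torus.strainProjection (fun a c y => M a c y - N a c y) a b x =
      Torus.strainProjection M a b x - Torus.strainProjection N a b x := by
  have hN' : ∀ a b, Torus.IsSmooth (fun y => (-1 : ℝ) * N a b y) := fun a b =>
    (Torus.isSmooth_const _).mul (hN a b)
  have hfun : (fun a c y => M a c y - N a c y) = fun a c y => M a c y + (-1 : ℝ) * N a c y := by
    funext a c y; ring
  rw [hfun, Torus.strainProjection_add hM hN', Torus.strainProjection_const_mul hN]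
  ring

/-! ### `ω⊗ω = W² + |ω|²I` pointwise, and the smoothness of `|ω|²` -/

/-- **`ωₐω_b = (W²)ₐ_b + δₐ_b|ω|²` pointwise on `T³`** (any labelling `e : d ≃ Fin 3`,
`ωₐ = W_{e⁻¹(e a+1), e⁻¹(e a+2)}`): the matrix identity `ω⊗ω = W² + |ω|²I` (Majda–Bertozzi 2002,
§1.4 (1.21) `Ωh = ½ω × h` applied twice), read off entrywise from the tree's quadratic-form version
`StrainVorticityOrthogonality.sum_vorticity_mul_mul_vorticity_eq`. [cite: MajdaBertozziCUP2002, §1.4 eq. (1.21)] -/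
theorem vorticity_mul_vorticity_eq (e : d ≃ Fin 3) (v : UnitAddTorus d → EuclideanSpace ℝ d)
    (a b : d) (x : UnitAddTorus d) :
    torusVorticityTensor v (e.symm (e a + 1)) (e.symm (e a + 2)) x *
        torusVorticityTensor v (e.symm (e b + 1)) (e.symm (e b + 2)) x =
      (∑ k, torusVorticityTensor v a k x * torusVorticityTensor v k b x) +
        (if a = b then torusVorticitySqAt v x else 0) := by
  classical
  have h := sum_vorticity_mul_mul_vorticity_eq e v (fun a' b' => if a' = a ∧ b' = b then 1 else 0) x
  have hL : ∑ a', ∑ b', torusVorticityTensor v (e.symm (e a' + 1)) (e.symm (e a' + 2)) x *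
      (if a' = a ∧ b' = b then (1 : ℝ) else 0) *
      torusVorticityTensor v (e.symm (e b' + 1)) (e.symm (e b' + 2)) x =
      torusVorticityTensor v (e.symm (e a + 1)) (e.symm (e a + 2)) x *
        torusVorticityTensor v (e.symm (e b + 1)) (e.symm (e b + 2)) x := by
    rw [Finset.sum_eq_single a (fun a' _ ha' => by simp [ha']) (by simp)]
    rw [Finset.sum_eq_single b (fun b' _ hb' => by simp [hb']) (by simp)]
    simp
  have hR1 : ∑ a', ∑ b', (if a' = a ∧ b' = b then (1 : ℝ) else 0) *
      ∑ k, torusVorticityTensor v a' k x * torusVorticityTensor v k b' x =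
      ∑ k, torusVorticityTensor v a k x * torusVorticityTensor v k b x := by
    rw [Finset.sum_eq_single a (fun a' _ ha' => by simp [ha']) (by simp)]
    rw [Finset.sum_eq_single b (fun b' _ hb' => by simp [hb']) (by simp)]
    simp
  have hR2 : (∑ a', (if a' = a ∧ a' = b then (1 : ℝ) else 0)) = if a = b then 1 else 0 := by
    rw [Finset.sum_eq_single a (fun a' _ ha' => by simp [ha']) (by simp)]
    simp
  rw [hL, hR1, hR2] at h
  rw [h]
  split_ifs <;> ring

/-- `|ω|²(x) = ½∑ᵢⱼWᵢⱼ(x)²` is smooth for a smooth field. [folklore] -/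
private theorem isSmooth_torusVorticitySqAt {v : UnitAddTorus d → EuclideanSpace ℝ d}
    (hv : Torus.IsSmooth v) : Torus.IsSmooth (torusVorticitySqAt v) := by
  have hW : ∀ i j, Torus.IsSmooth (torusVorticityTensor v i j) := fun i j =>
    ((hv.partialDeriv i).apply j).sub ((hv.partialDeriv j).apply i)
  have h : Torus.IsSmooth (fun x => 2⁻¹ * ∑ i, ∑ j, torusVorticityTensor v i j x ^ 2) :=
    (Torus.isSmooth_const _).mul (isSmooth_sum' _ fun i _ => isSmooth_sum' _ fun j _ => smooth_sq' (hW i j))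
  have e : torusVorticitySqAt v = fun x => 2⁻¹ * ∑ i, ∑ j, torusVorticityTensor v i j x ^ 2 := by
    funext x; rfl
  rw [e]
  exact h

/-! ### `P_{st}((u·∇)S + S² + ¼ω⊗ω) = ∇_{sym}((u·∇)u + ∇p)` -/

/-- **The projected strain nonlinearity is the symmetric gradient of the material acceleration**
(`W`-form, every dimension): for a smooth divergence-free `u` on `T^d` and a smooth `p` such that
`(u·∇)u + ∇p` is divergence free (the pressure Poisson equation `−Δp = div((u·∇)u)`),
`P_{st}((u·∇)S + S² + ¼W²) = ∇_{sym}((u·∇)u + ∇p)`: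
`∇_{sym}((u·∇)u) = (u·∇)S + S² + ¼W²` (Miller, ARMA 235 (2020), Prop 2.1: "`∇_{sym}((u·∇)u) =
(u·∇)S + S² + A²`"), `∇_{sym}∇p = Hess(p) ∈ (L²_{st})^⊥` (Prop 2.4) and `∇_{sym}` of a divergence-free
field is fixed by `P_{st}` — the content of writing the strain equation "in terms of the projection
onto `L²_{st}`" (Anal. PDE 16 (2023), (1.9)). [cite: Miller2019, Prop 2.1 and Prop 2.4; Miller2023StrainModel, eq. (1.9)] -/
theorem _root_.Literature.Analysis.FluidPDE.Torus.strainProjection_symGradConvect_vorticityTensor_eq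
    [Nonempty d] {u : UnitAddTorus d → EuclideanSpace ℝ d} (hu : Torus.IsSmooth u)
    {p : UnitAddTorus d → ℝ} (hp : Torus.IsSmooth p)
    (hw : Torus.IsDivFree (fun x => Torus.convect u u x + Torus.gradient p x))
    (a b : d) (x : UnitAddTorus d) :
    Torus.strainProjection (fun a b x =>
        (∑ c, u x c * Torus.partialDeriv c
            (fun y => (Torus.partialDeriv b u y a + Torus.partialDeriv a u y b) / 2) x) +
          (∑ c, ((Torus.partialDeriv c u x a + Torus.partialDeriv a u x c) / 2) *
            ((Torus.partialDeriv b u x c + Torus.partialDeriv c u x b) / 2)) +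
          4⁻¹ * ∑ c, torusVorticityTensor u a c x * torusVorticityTensor u c b x) a b x =
      (Torus.partialDeriv b (fun y => Torus.convect u u y + Torus.gradient p y) x a +
        Torus.partialDeriv a (fun y => Torus.convect u u y + Torus.gradient p y) x b) / 2 := by
  set w : UnitAddTorus d → EuclideanSpace ℝ d := fun y => Torus.convect u u y + Torus.gradient p y with hw_def
  have hF : Torus.IsSmooth (Torus.convect u u) := hu.convect hu
  have hG : Torus.IsSmooth (Torus.gradient p) := hp.gradient
  have hws : Torus.IsSmooth w := hF.add hG
  have hp1 : Torus.IsContDiff 1 p := hp.isContDiff (by simp)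
  -- `∂_a w _b = ∂_a((u·∇)u)_b + ∂_a∂_b p`
  have hdw : ∀ a b, Torus.partialDeriv a w x b =
      Torus.partialDeriv a (Torus.convect u u) x b + Torus.partialDeriv a (Torus.partialDeriv b p) x := by
    intro a b
    have e1 : w = Torus.convect u u + Torus.gradient p := rfl
    rw [e1, Torus.partialDeriv_add (hF.isContDiff (by simp)) (hG.isContDiff (by simp)), Pi.add_apply,
      PiLp.add_apply, ← Torus.partialDeriv_apply_coord (hG.isContDiff (by simp))]
    congr 2
    funext y
    exact Torus.gradient_apply hp1 y b
  -- Schwarz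
  have hH : ∀ a b, Torus.partialDeriv a (Torus.partialDeriv b p) x = Torus.partialDeriv b (Torus.partialDeriv a p) x :=
    fun a b => Torus.partialDeriv_comm hp a b x
  -- the matrix field is `∇_{sym}w − Hess p`
  have hMN : (fun a b x => (∑ c, u x c * Torus.partialDeriv c
        (fun y => (Torus.partialDeriv b u y a + Torus.partialDeriv a u y b) / 2) x) +
        (∑ c, ((Torus.partialDeriv c u x a + Torus.partialDeriv a u x c) / 2) *
          ((Torus.partialDeriv b u x c + Torus.partialDeriv c u x b) / 2)) +
        4⁻¹ * ∑ c, torusVorticityTensor u a c x * torusVorticityTensor u c b x) =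
      fun a b x => (Torus.partialDeriv b w x a + Torus.partialDeriv a w x b) / 2 -
        Torus.partialDeriv a (Torus.partialDeriv b p) x := by
    funext a b y
    rw [← symGrad_convect_apply hu a b y]
    have hdw' : ∀ a b, Torus.partialDeriv a w y b =
        Torus.partialDeriv a (Torus.convect u u) y b + Torus.partialDeriv a (Torus.partialDeriv b p) y := by
      intro a b
      have e1 : w = Torus.convect u u + Torus.gradient p := rfl
      rw [e1, Torus.partialDeriv_add (hF.isContDiff (by simp)) (hG.isContDiff (by simp)), Pi.add_apply,
        PiLp.add_apply, ← Torus.partialDeriv_apply_coord (hG.isContDiff (by simp))]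
      congr 2
      funext z
      exact Torus.gradient_apply hp1 z b
    rw [hdw' b a, hdw' a b, Torus.partialDeriv_comm hp b a y]
    ring
  rw [hMN]
  have hS : ∀ a b, Torus.IsSmooth (fun y => (Torus.partialDeriv b w y a + Torus.partialDeriv a w y b) / 2) :=
    fun a b => (((hws.partialDeriv b).apply a).add ((hws.partialDeriv a).apply b)).div_const 2
  have hHs : ∀ a b, Torus.IsSmooth (fun y => Torus.partialDeriv a (Torus.partialDeriv b p) y) :=
    fun a b => (hp.partialDeriv b).partialDeriv a
  rw [Torus.strainProjection_sub hS hHs, Torus.strainProjection_symGrad hws hw,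
    Torus.strainProjection_hessian hp, sub_zero]

/-- **`P_{st}((u·∇)S + S² + ¼ω⊗ω) = ∇_{sym}((u·∇)u + ∇p)` on `T³`** (frame `e : d ≃ Fin 3`,
`ωₐ = W_{e⁻¹(e a+1), e⁻¹(e a+2)}`): Miller's projected nonlinearity of the Navier–Stokes strain equation
"`∂ₜS − ΔS + P_{st}((u·∇)S + S² + ¼ω⊗ω) = 0`" (Anal. PDE 16 (2023), (1.9); Pure Appl. Anal. 8 (2026),
(1.6)/(5.9)) equals the symmetric gradient of `(u·∇)u + ∇p`, for smooth divergence-free `u` and smooth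
`p` with `div((u·∇)u + ∇p) = 0`: from the `W`-form and `¼ω⊗ω = ¼W² + ¼|ω|²I`, `P_{st}(|ω|²I) = 0`
(ARMA 235 (2020), Prop 2.4). [cite: Miller2023StrainModel, eq. (1.9); Miller2019, Prop 2.1 and Prop 2.4] -/
theorem _root_.Literature.Analysis.FluidPDE.Torus.strainProjection_symGradConvect_vorticity_eq
    (e : d ≃ Fin 3) {u : UnitAddTorus d → EuclideanSpace ℝ d} (hu : Torus.IsSmooth u)
    {p : UnitAddTorus d → ℝ} (hp : Torus.IsSmooth p)
    (hw : Torus.IsDivFree (fun x => Torus.convect u u x + Torus.gradient p x))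
    (a b : d) (x : UnitAddTorus d) :
    Torus.strainProjection (fun a b x =>
        (∑ c, u x c * Torus.partialDeriv c
            (fun y => (Torus.partialDeriv b u y a + Torus.partialDeriv a u y b) / 2) x) +
          (∑ c, ((Torus.partialDeriv c u x a + Torus.partialDeriv a u x c) / 2) *
            ((Torus.partialDeriv b u x c + Torus.partialDeriv c u x b) / 2)) +
          4⁻¹ * (torusVorticityTensor u (e.symm (e a + 1)) (e.symm (e a + 2)) x *
            torusVorticityTensor u (e.symm (e b + 1)) (e.symm (e b + 2)) x)) a b x =
      (Torus.partialDeriv b (fun y => Torus.convect u u y + Torus.gradient p y) x a +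
        Torus.partialDeriv a (fun y => Torus.convect u u y + Torus.gradient p y) x b) / 2 := by
  haveI : Nonempty d := ⟨e.symm 0⟩
  have hvc : ∀ c, Torus.IsSmooth (fun y => u y c) := fun c => hu.apply c
  have hSt : ∀ a b, Torus.IsSmooth (fun y => (Torus.partialDeriv b u y a + Torus.partialDeriv a u y b) / 2) :=
    fun a b => (((hu.partialDeriv b).apply a).add ((hu.partialDeriv a).apply b)).div_const 2
  have hW : ∀ i j, Torus.IsSmooth (torusVorticityTensor u i j) := fun i j =>
    ((hu.partialDeriv i).apply j).sub ((hu.partialDeriv j).apply i)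
  -- the `W`-form field `N_W` and the diagonal field `¼|ω|² I`
  set NW : d → d → UnitAddTorus d → ℝ := fun a b x =>
    (∑ c, u x c * Torus.partialDeriv c
        (fun y => (Torus.partialDeriv b u y a + Torus.partialDeriv a u y b) / 2) x) +
      (∑ c, ((Torus.partialDeriv c u x a + Torus.partialDeriv a u x c) / 2) *
        ((Torus.partialDeriv b u x c + Torus.partialDeriv c u x b) / 2)) +
      4⁻¹ * ∑ c, torusVorticityTensor u a c x * torusVorticityTensor u c b x with hNW
  set D : d → d → UnitAddTorus d → ℝ := fun a b x =>
    4⁻¹ * (if a = b then torusVorticitySqAt u x else 0) with hD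
  have hNWs : ∀ a b, Torus.IsSmooth (NW a b) := by
    intro a b
    have h1 : Torus.IsSmooth (fun x => ∑ c, u x c * Torus.partialDeriv c
        (fun y => (Torus.partialDeriv b u y a + Torus.partialDeriv a u y b) / 2) x) :=
      isSmooth_sum' _ fun c _ => smooth_mul' (hvc c) ((hSt a b).partialDeriv c)
    have h2 : Torus.IsSmooth (fun x => ∑ c, ((Torus.partialDeriv c u x a + Torus.partialDeriv a u x c) / 2) *
        ((Torus.partialDeriv b u x c + Torus.partialDeriv c u x b) / 2)) :=
      isSmooth_sum' _ fun c _ => smooth_mul'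
        ((((hu.partialDeriv c).apply a).add ((hu.partialDeriv a).apply c)).div_const 2)
        ((((hu.partialDeriv b).apply c).add ((hu.partialDeriv c).apply b)).div_const 2)
    have h3 : Torus.IsSmooth (fun x => 4⁻¹ * ∑ c, torusVorticityTensor u a c x * torusVorticityTensor u c b x) :=
      (Torus.isSmooth_const _).mul (isSmooth_sum' _ fun c _ => smooth_mul' (hW a c) (hW c b))
    exact (h1.add h2).add h3
  have hDs : ∀ a b, Torus.IsSmooth (D a b) := by
    intro a b
    by_cases h : a = b
    · have e1 : D a b = fun x => 4⁻¹ * torusVorticitySqAt u x := by funext x; simp [hD, h]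
      rw [e1]
      exact (Torus.isSmooth_const _).mul (isSmooth_torusVorticitySqAt hu)
    · have e1 : D a b = fun _ => 0 := by funext x; simp [hD, h]
      rw [e1]
      exact Torus.isSmooth_const _
  -- the `ω`-form field is `N_W + D`
  have hsplit : (fun a b x =>
      (∑ c, u x c * Torus.partialDeriv c
          (fun y => (Torus.partialDeriv b u y a + Torus.partialDeriv a u y b) / 2) x) +
        (∑ c, ((Torus.partialDeriv c u x a + Torus.partialDeriv a u x c) / 2) *
          ((Torus.partialDeriv b u x c + Torus.partialDeriv c u x b) / 2)) +
        4⁻¹ * (torusVorticityTensor u (e.symm (e a + 1)) (e.symm (e a + 2)) x *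
          torusVorticityTensor u (e.symm (e b + 1)) (e.symm (e b + 2)) x)) =
      fun a b x => NW a b x + D a b x := by
    funext a b x
    rw [vorticity_mul_vorticity_eq e u a b x]
    simp only [hNW, hD]
    ring
  rw [hsplit, Torus.strainProjection_add hNWs hDs,
    Torus.strainProjection_symGradConvect_vorticityTensor_eq hu hp hw]
  -- `P_{st}(¼|ω|² I) = 0`
  have hD0 : Torus.strainProjection D a b x = 0 := by
    have e1 : D = fun a b x => 4⁻¹ * (fun (a' b' : d) (x' : UnitAddTorus d) => if a' = b' then torusVorticitySqAt u x' else 0) a b x := by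
      funext a b x; rfl
    have hIs : ∀ a b, Torus.IsSmooth ((fun (a' b' : d) (x' : UnitAddTorus d) => if a' = b' then torusVorticitySqAt u x' else (0 : ℝ)) a b) := by
      intro a b
      by_cases h : a = b
      · have e2 : (fun (a' b' : d) (x' : UnitAddTorus d) => if a' = b' then torusVorticitySqAt u x' else (0 : ℝ)) a b =
            torusVorticitySqAt u := by
          funext x; simp [h]
        rw [e2]; exact isSmooth_torusVorticitySqAt hu
      · have e2 : (fun (a' b' : d) (x' : UnitAddTorus d) => if a' = b' then torusVorticitySqAt u x' else (0 : ℝ)) a b =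
            fun _ => 0 := by
          funext x; simp [h]
        rw [e2]; exact Torus.isSmooth_const _
    rw [e1, Torus.strainProjection_const_mul hIs, Torus.strainProjection_diagonal (isSmooth_torusVorticitySqAt hu),
      mul_zero]
  rw [hD0, add_zero]

/-! ### Along classical solutions: `div((u·∇)u + ∇p) = 0` and the projected strain equation -/

/-- `div(c f − g) = 0` for smooth divergence-free `f`, `g`. [folklore] -/
private theorem isDivFree_smul_sub {f g : UnitAddTorus d → EuclideanSpace ℝ d} (hf : Torus.IsSmooth f)
    (hg : Torus.IsSmooth g) (hdf : Torus.IsDivFree f) (hdg : Torus.IsDivFree g) (c : ℝ) :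
    Torus.IsDivFree (fun x => c • f x - g x) := by
  intro x
  have hf1 : Torus.IsContDiff 1 f := hf.isContDiff (by simp)
  have hg1 : Torus.IsContDiff 1 g := hg.isContDiff (by simp)
  have hcf1 : Torus.IsContDiff 1 (c • f) := (hf.smul c).isContDiff (by simp)
  have hfg : Torus.IsContDiff 1 (c • f - g) := ((hf.smul c).sub hg).isContDiff (by simp)
  have e1 : (fun x => c • f x - g x) = c • f - g := rfl
  rw [e1, Torus.divergence_eq_sum_partialDeriv_apply hfg]
  simp only [Torus.partialDeriv_sub hcf1 hg1, Torus.partialDeriv_const_smul hf1, Pi.sub_apply,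
    Pi.smul_apply, PiLp.sub_apply, PiLp.smul_apply, smul_eq_mul, Finset.sum_sub_distrib, ← Finset.mul_sum]
  have h1 := hdf x
  have h2 := hdg x
  rw [Torus.divergence_eq_sum_partialDeriv_apply hf1] at h1
  rw [Torus.divergence_eq_sum_partialDeriv_apply hg1] at h2
  rw [h1, h2, mul_zero, sub_zero]

variable {a b ν : ℝ} {u : ℝ → UnitAddTorus d → EuclideanSpace ℝ d} {p : ℝ → UnitAddTorus d → ℝ}

/-- **`div((u·∇)u + ∇p) = 0` along a classical solution** of the unforced Navier–Stokes equations on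
`[a, b] × T^d` (`a < b`): `(u·∇)u + ∇p = νΔu − ∂ₜu` pointwise (momentum equation) and both `Δu`
and `∂ₜu` are divergence free — the pressure Poisson equation `−Δp = div((u·∇)u)` in divergence
form (Robinson–Rodrigo–Sadowski 2016, (5.3)). [cite: RobinsonRodrigoSadowskiCUP2016, Ch. 5 eq. (5.3)] -/
theorem _root_.Literature.Analysis.FunctionSpaces.Torus.IsClassicalNSSolutionOn.isDivFree_convect_add_gradient
    (h : Torus.IsClassicalNSSolutionOn (Icc a b) ν 0 u p) (hab : a < b) {t : ℝ} (ht : t ∈ Icc a b) :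
    Torus.IsDivFree (fun x => Torus.convect (u t) (u t) x + Torus.gradient (p t) x) := by
  have hS : UniqueDiffOn ℝ (Icc a b) := uniqueDiffOn_Icc hab
  have hut : Torus.IsSmooth (u t) := h.smooth_velocity.isSmooth_slice ht
  have hdt : Torus.IsSmooth (Torus.timeDerivWithin (Icc a b) u t) :=
    h.smooth_velocity.isSmooth_timeDerivWithin hS ht
  have hm : ∀ y, Torus.convect (u t) (u t) y + Torus.gradient (p t) y =
      ν • Torus.laplacian (u t) y - Torus.timeDerivWithin (Icc a b) u t y := by
    intro y
    have h1 := h.momentum t ht y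
    simp only [Pi.zero_apply, add_zero] at h1
    rw [eq_sub_iff_add_eq]
    calc Torus.convect (u t) (u t) y + Torus.gradient (p t) y + Torus.timeDerivWithin (Icc a b) u t y
        = (Torus.timeDerivWithin (Icc a b) u t y + Torus.convect (u t) (u t) y) + Torus.gradient (p t) y := by
          abel
      _ = ν • Torus.laplacian (u t) y := by rw [h1]; abel
  have e : (fun x => Torus.convect (u t) (u t) x + Torus.gradient (p t) x) =
      fun x => ν • Torus.laplacian (u t) x - Torus.timeDerivWithin (Icc a b) u t x := funext hm
  rw [e]
  exact isDivFree_smul_sub hut.laplacian hdt (Torus.IsDivFree.laplacian_of_isSmooth hut (h.divFree t ht))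
    (h.smooth_velocity.isDivFree_timeDerivWithin hab h.divFree ht) ν

/-- **The time derivative of the strain along a classical solution**: on `[a, b] × T^d` (`a < b`),
`∂ₜS_{ij} = ½((∂ᵢ∂ₜu)ⱼ + (∂ⱼ∂ₜu)ᵢ)` (one-sided in time within `[a, b]`; `∂ₜ∂ᵢ = ∂ᵢ∂ₜ` for jointly
smooth fields). [folklore] -/
private theorem timeDerivWithin_strain_eq_symGrad_timeDerivWithin
    (h : Torus.IsClassicalNSSolutionOn (Icc a b) ν 0 u p) (hab : a < b) {t : ℝ} (ht : t ∈ Icc a b)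
    (i j : d) (x : UnitAddTorus d) :
    Torus.timeDerivWithin (Icc a b)
        (fun s y => (Torus.partialDeriv i (u s) y j + Torus.partialDeriv j (u s) y i) / 2) t x =
      (Torus.partialDeriv i (Torus.timeDerivWithin (Icc a b) u t) x j +
        Torus.partialDeriv j (Torus.timeDerivWithin (Icc a b) u t) x i) / 2 := by
  have hS : UniqueDiffOn ℝ (Icc a b) := uniqueDiffOn_Icc hab
  have hu := h.smooth_velocity
  set A : ℝ → UnitAddTorus d → ℝ := fun s y => Torus.partialDeriv i (u s) y j with hA
  set B : ℝ → UnitAddTorus d → ℝ := fun s y => Torus.partialDeriv j (u s) y i with hB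
  have hAs : Torus.IsSmoothSpaceTimeOn (Icc a b) A := (hu.partialDeriv hS i).apply j
  have hBs : Torus.IsSmoothSpaceTimeOn (Icc a b) B := (hu.partialDeriv hS j).apply i
  have hF : (fun s y => (Torus.partialDeriv i (u s) y j + Torus.partialDeriv j (u s) y i) / 2) =
      fun s y => (2⁻¹ : ℝ) • (A s y + B s y) := by
    funext s y; simp only [hA, hB, smul_eq_mul]; ring
  rw [hF]
  have h1 : Torus.timeDerivWithin (Icc a b) (fun s y => (2⁻¹ : ℝ) • (A s y + B s y)) t x =
      (2⁻¹ : ℝ) • Torus.timeDerivWithin (Icc a b) (fun s y => A s y + B s y) t x :=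
    Torus.timeDerivWithin_const_smul (hAs.add hBs) hS _ ht x
  have h2 : Torus.timeDerivWithin (Icc a b) (fun s y => A s y + B s y) t x =
      Torus.timeDerivWithin (Icc a b) A t x + Torus.timeDerivWithin (Icc a b) B t x :=
    Torus.timeDerivWithin_add hAs hBs hS ht x
  have hA' : Torus.timeDerivWithin (Icc a b) A t x =
      Torus.partialDeriv i (Torus.timeDerivWithin (Icc a b) u t) x j := by
    have hk : Torus.timeDerivWithin (Icc a b) (fun s y => Torus.partialDeriv i (u s) y j) t x =
        (Torus.timeDerivWithin (Icc a b) (fun s => Torus.partialDeriv i (u s)) t x) j :=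
      Torus.timeDerivWithin_clm_comp (hu.partialDeriv hS i) hS (EuclideanSpace.proj j) ht x
    rw [hA, hk, Torus.timeDerivWithin_partialDeriv_comm hab hu ht i x]
  have hB' : Torus.timeDerivWithin (Icc a b) B t x =
      Torus.partialDeriv j (Torus.timeDerivWithin (Icc a b) u t) x i := by
    have hk : Torus.timeDerivWithin (Icc a b) (fun s y => Torus.partialDeriv j (u s) y i) t x =
        (Torus.timeDerivWithin (Icc a b) (fun s => Torus.partialDeriv j (u s)) t x) i :=
      Torus.timeDerivWithin_clm_comp (hu.partialDeriv hS j) hS (EuclideanSpace.proj i) ht x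
    rw [hB, hk, Torus.timeDerivWithin_partialDeriv_comm hab hu ht j x]
  rw [h1, h2, hA', hB', smul_eq_mul]
  ring

/-- **The Navier–Stokes strain equation in projected form on `T³`, along classical solutions**
(Miller, ARMA 235 (2020), Prop 2.1 "Suppose `u` is a classical solution to the Navier–Stokes equation.
Then `S = ∇_{sym}(u)` is a classical solution to the Navier–Stokes strain equation
`∂ₜS + (u·∇)S − ΔS + S² + ¼ω⊗ω − ¼|ω|²I₃ + Hess(p) = 0`", combined with Prop 2.4
(`Hess(p), |ω|²I₃ ∈ (L²_{st})^⊥`) into the projected form "`∂ₜS − ΔS + P_{st}((u·∇)S + S² + ¼ω⊗ω) = 0`"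
of Anal. PDE 16 (2023), (1.9)): for a classical solution of the unforced equations with viscosity `ν`
on `[a, b] × T^d` (`card d = 3` via the frame `e`), every `t ∈ [a, b]`, `i, j`, `x`:
`∂ₜS_{ij} = ν(ΔS)_{ij} − (P_{st}((u·∇)S + S² + ¼ω⊗ω))_{ij}`, `(ΔS)_{ij} = ½((∂ᵢΔu)ⱼ + (∂ⱼΔu)ᵢ)`, the
time derivative one-sided within `[a, b]`. [cite: Miller2019, Prop 2.1 and Prop 2.4; Miller2023StrainModel, eq. (1.9)] -/
theorem _root_.Literature.Analysis.FunctionSpaces.Torus.IsClassicalNSSolutionOn.timeDerivWithin_strain_eq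
    (e : d ≃ Fin 3) (h : Torus.IsClassicalNSSolutionOn (Icc a b) ν 0 u p) (hab : a < b) {t : ℝ}
    (ht : t ∈ Icc a b) (i j : d) (x : UnitAddTorus d) :
    Torus.timeDerivWithin (Icc a b)
        (fun s y => (Torus.partialDeriv i (u s) y j + Torus.partialDeriv j (u s) y i) / 2) t x =
      ν * ((Torus.partialDeriv i (Torus.laplacian (u t)) x j +
          Torus.partialDeriv j (Torus.laplacian (u t)) x i) / 2) -
        Torus.strainProjection (fun a b x =>
          (∑ c, u t x c * Torus.partialDeriv c
              (fun y => (Torus.partialDeriv b (u t) y a + Torus.partialDeriv a (u t) y b) / 2) x) +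
            (∑ c, ((Torus.partialDeriv c (u t) x a + Torus.partialDeriv a (u t) x c) / 2) *
              ((Torus.partialDeriv b (u t) x c + Torus.partialDeriv c (u t) x b) / 2)) +
            4⁻¹ * (torusVorticityTensor (u t) (e.symm (e a + 1)) (e.symm (e a + 2)) x *
              torusVorticityTensor (u t) (e.symm (e b + 1)) (e.symm (e b + 2)) x)) i j x := by
  have hS : UniqueDiffOn ℝ (Icc a b) := uniqueDiffOn_Icc hab
  have hut : Torus.IsSmooth (u t) := h.smooth_velocity.isSmooth_slice ht
  have hpt : Torus.IsSmooth (p t) := h.smooth_pressure.isSmooth_slice ht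
  have hdt : Torus.IsSmooth (Torus.timeDerivWithin (Icc a b) u t) :=
    h.smooth_velocity.isSmooth_timeDerivWithin hS ht
  set w : UnitAddTorus d → EuclideanSpace ℝ d := fun y => Torus.convect (u t) (u t) y + Torus.gradient (p t) y
    with hw_def
  have hws : Torus.IsSmooth w := (hut.convect hut).add hpt.gradient
  have hw : Torus.IsDivFree w := h.isDivFree_convect_add_gradient hab ht
  -- momentum: `∂ₜu = νΔu − w`
  have hm : Torus.timeDerivWithin (Icc a b) u t = ν • Torus.laplacian (u t) - w := by
    funext y
    have h1 := h.momentum t ht y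
    simp only [Pi.zero_apply, add_zero] at h1
    rw [Pi.sub_apply, Pi.smul_apply, eq_sub_iff_add_eq]
    calc Torus.timeDerivWithin (Icc a b) u t y + w y
        = (Torus.timeDerivWithin (Icc a b) u t y + Torus.convect (u t) (u t) y) + Torus.gradient (p t) y := by
          simp only [hw_def]; abel
      _ = ν • Torus.laplacian (u t) y := by rw [h1]; abel
  have hL1 : Torus.IsContDiff 1 (ν • Torus.laplacian (u t)) := (hut.laplacian.smul ν).isContDiff (by simp)
  have hw1 : Torus.IsContDiff 1 w := hws.isContDiff (by simp)
  have hdu : ∀ i j, Torus.partialDeriv i (Torus.timeDerivWithin (Icc a b) u t) x j =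
      ν * Torus.partialDeriv i (Torus.laplacian (u t)) x j - Torus.partialDeriv i w x j := by
    intro i j
    rw [hm, Torus.partialDeriv_sub hL1 hw1, Torus.partialDeriv_const_smul (hut.laplacian.isContDiff (by simp))]
    simp only [Pi.sub_apply, Pi.smul_apply, PiLp.sub_apply, PiLp.smul_apply, smul_eq_mul]
  rw [timeDerivWithin_strain_eq_symGrad_timeDerivWithin h hab ht, hdu i j, hdu j i,
    Torus.strainProjection_symGradConvect_vorticity_eq e hut hpt hw i j x]
  simp only [hw_def]
  ring

/-- **Miller's strain reformulation of the dynamics, `W`-form in every dimension** (ARMA 235 (2020),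
Prop 2.1: "Suppose `u` is a classical solution to the Navier–Stokes equation. Then `S = ∇_{sym}(u)` is a
classical solution to the Navier–Stokes strain equation
`∂ₜS + (u·∇)S − ΔS + S² + ¼ω⊗ω − ¼|ω|²I₃ + Hess(p) = 0`", proof: "`∇_{sym}((u·∇)u) = (u·∇)S + S² + A²`,
`A² = ¼ω⊗ω − ¼|ω|²I₃`"): along a classical solution of the unforced equations with viscosity `ν` on
`[a, b] × T^d`, `∂ₜS_{ij} = ν(ΔS)_{ij} − ((u·∇)S + S² + ¼W²)_{ij} − ∂ᵢ∂ⱼp` pointwise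
(`(W²)_{ij} = ∑_c W_{ic}W_{cj} = (A²)`-term written with `W = 2Aᵀ`; any `d`).
[cite: Miller2019, Prop 2.1] -/
theorem _root_.Literature.Analysis.FunctionSpaces.Torus.IsClassicalNSSolutionOn.timeDerivWithin_strain_eq_vorticityTensor
    (h : Torus.IsClassicalNSSolutionOn (Icc a b) ν 0 u p) (hab : a < b) {t : ℝ}
    (ht : t ∈ Icc a b) (i j : d) (x : UnitAddTorus d) :
    Torus.timeDerivWithin (Icc a b)
        (fun s y => (Torus.partialDeriv i (u s) y j + Torus.partialDeriv j (u s) y i) / 2) t x =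
      ν * ((Torus.partialDeriv i (Torus.laplacian (u t)) x j +
          Torus.partialDeriv j (Torus.laplacian (u t)) x i) / 2) -
        ((∑ c, u t x c * Torus.partialDeriv c
            (fun y => (Torus.partialDeriv j (u t) y i + Torus.partialDeriv i (u t) y j) / 2) x) +
          (∑ c, ((Torus.partialDeriv c (u t) x i + Torus.partialDeriv i (u t) x c) / 2) *
            ((Torus.partialDeriv j (u t) x c + Torus.partialDeriv c (u t) x j) / 2)) +
          4⁻¹ * ∑ c, torusVorticityTensor (u t) i c x * torusVorticityTensor (u t) c j x) -
        Torus.partialDeriv i (Torus.partialDeriv j (p t)) x := by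
  have hS : UniqueDiffOn ℝ (Icc a b) := uniqueDiffOn_Icc hab
  have hut : Torus.IsSmooth (u t) := h.smooth_velocity.isSmooth_slice ht
  have hpt : Torus.IsSmooth (p t) := h.smooth_pressure.isSmooth_slice ht
  have hp1 : Torus.IsContDiff 1 (p t) := hpt.isContDiff (by simp)
  have hF : Torus.IsSmooth (Torus.convect (u t) (u t)) := hut.convect hut
  have hG : Torus.IsSmooth (Torus.gradient (p t)) := hpt.gradient
  set w : UnitAddTorus d → EuclideanSpace ℝ d := fun y => Torus.convect (u t) (u t) y + Torus.gradient (p t) y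
    with hw_def
  have hws : Torus.IsSmooth w := hF.add hG
  -- momentum: `∂ₜu = νΔu − w`
  have hm : Torus.timeDerivWithin (Icc a b) u t = ν • Torus.laplacian (u t) - w := by
    funext y
    have h1 := h.momentum t ht y
    simp only [Pi.zero_apply, add_zero] at h1
    rw [Pi.sub_apply, Pi.smul_apply, eq_sub_iff_add_eq]
    calc Torus.timeDerivWithin (Icc a b) u t y + w y
        = (Torus.timeDerivWithin (Icc a b) u t y + Torus.convect (u t) (u t) y) + Torus.gradient (p t) y := by
          simp only [hw_def]; abel
      _ = ν • Torus.laplacian (u t) y := by rw [h1]; abel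
  have hL1 : Torus.IsContDiff 1 (ν • Torus.laplacian (u t)) := (hut.laplacian.smul ν).isContDiff (by simp)
  have hw1 : Torus.IsContDiff 1 w := hws.isContDiff (by simp)
  have hdu : ∀ i j, Torus.partialDeriv i (Torus.timeDerivWithin (Icc a b) u t) x j =
      ν * Torus.partialDeriv i (Torus.laplacian (u t)) x j - Torus.partialDeriv i w x j := by
    intro i j
    rw [hm, Torus.partialDeriv_sub hL1 hw1, Torus.partialDeriv_const_smul (hut.laplacian.isContDiff (by simp))]
    simp only [Pi.sub_apply, Pi.smul_apply, PiLp.sub_apply, PiLp.smul_apply, smul_eq_mul]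
  -- `∂ᵢw_j = ∂ᵢ((u·∇)u)_j + ∂ᵢ∂ⱼp`
  have hdw : ∀ i j, Torus.partialDeriv i w x j =
      Torus.partialDeriv i (Torus.convect (u t) (u t)) x j +
        Torus.partialDeriv i (Torus.partialDeriv j (p t)) x := by
    intro i j
    have e1 : w = Torus.convect (u t) (u t) + Torus.gradient (p t) := rfl
    rw [e1, Torus.partialDeriv_add (hF.isContDiff (by simp)) (hG.isContDiff (by simp)), Pi.add_apply,
      PiLp.add_apply, ← Torus.partialDeriv_apply_coord (hG.isContDiff (by simp))]
    congr 2
    funext y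
    exact Torus.gradient_apply hp1 y j
  rw [timeDerivWithin_strain_eq_symGrad_timeDerivWithin h hab ht, hdu i j, hdu j i, hdw i j, hdw j i,
    Torus.partialDeriv_comm hpt j i x, ← symGrad_convect_apply hut i j x]
  ring

/-- **Miller's strain reformulation of the dynamics on `T³`, as printed** (ARMA 235 (2020), Prop 2.1:
`∂ₜS + (u·∇)S − ΔS + S² + ¼ω⊗ω − ¼|ω|²I₃ + Hess(p) = 0`; viscosity `ν` restored): along a classical
solution of the unforced equations on `[a, b] × T^d` read in a frame `e : d ≃ Fin 3`
(`ωₐ = W_{e⁻¹(e a+1), e⁻¹(e a+2)}`, `|ω|² = torusVorticitySqAt`),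
`∂ₜS_{ij} = ν(ΔS)_{ij} − ((u·∇)S)_{ij} − (S²)_{ij} − ¼ωᵢωⱼ + ¼|ω|²δ_{ij} − ∂ᵢ∂ⱼp` pointwise.
[cite: Miller2019, Prop 2.1] -/
theorem _root_.Literature.Analysis.FunctionSpaces.Torus.IsClassicalNSSolutionOn.timeDerivWithin_strain_eq_vorticity
    (e : d ≃ Fin 3) (h : Torus.IsClassicalNSSolutionOn (Icc a b) ν 0 u p) (hab : a < b) {t : ℝ}
    (ht : t ∈ Icc a b) (i j : d) (x : UnitAddTorus d) :
    Torus.timeDerivWithin (Icc a b)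
        (fun s y => (Torus.partialDeriv i (u s) y j + Torus.partialDeriv j (u s) y i) / 2) t x =
      ν * ((Torus.partialDeriv i (Torus.laplacian (u t)) x j +
          Torus.partialDeriv j (Torus.laplacian (u t)) x i) / 2) -
        (∑ c, u t x c * Torus.partialDeriv c
            (fun y => (Torus.partialDeriv j (u t) y i + Torus.partialDeriv i (u t) y j) / 2) x) -
        (∑ c, ((Torus.partialDeriv c (u t) x i + Torus.partialDeriv i (u t) x c) / 2) *
            ((Torus.partialDeriv j (u t) x c + Torus.partialDeriv c (u t) x j) / 2)) -
        4⁻¹ * (torusVorticityTensor (u t) (e.symm (e i + 1)) (e.symm (e i + 2)) x *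
          torusVorticityTensor (u t) (e.symm (e j + 1)) (e.symm (e j + 2)) x) +
        4⁻¹ * (if i = j then torusVorticitySqAt (u t) x else 0) -
        Torus.partialDeriv i (Torus.partialDeriv j (p t)) x := by
  rw [h.timeDerivWithin_strain_eq_vorticityTensor hab ht i j x, vorticity_mul_vorticity_eq e (u t) i j x]
  ring

end StrainEquationProjected

end Literature.Analysis.FluidPDE
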